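import Summits.HodgeConjecture.HodgeConjecture.Cruxes.BlochSeedDiscOne.BoxIdentity

/-!
# SlabRotation — the quarter-turn covariance of the slab ∕ box calculus (hsemireg-sheaf8-1 g8; R-B custody instrument)

Token: line stmt-HodgeConjecture-18881 Cruxes/BlochSeedDiscOne/Lines/birth.lean 814a6a70c14e831a stub_rung_pad4_seedAt.
LETTER-MODEL BOOKKEEPING ONLY; nothing here is proved toward HC ∕ HC_CM ∕ HC_AV ∕ №4 ∕ 26512 ∕ 18881 ∕ H2.  No `sorry` ∕ axiom ∕ `instance` ∕ `decide` ∕ `native_decide`.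

The kernel hook behind the ORBIT-EXACT readers of this seat (bus RESULT-9∕10, memo `SIGNLP-BOXLP-sheaf8-1-g8.md`): the quarter turn
`DepthBoundA4.Letter.rotI` (`β ↦ i·β`, `(x, y) ↦ (−y, x)`) shifts the phase index of `BoxIdentity.spro` ∕ `slab` by one,
`slab_t(i·ℓ) = slab_{t−1}(ℓ)`; hence the factorwise rotation `DepthBoundA4.rotCell k` moves the box weight `ψ_x` to `ψ_{x−k}` and the box class
`wt x` by `−wt k`, and the rotations of `DepthBoundA4.InS0` (`Σ k_f ≡ 0 mod 4`) PRESERVE every box class — which is why the class-summed box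
identities, the cover rows and the D-MASS rows are invariant under `S₀ ⋊ S₄`, so an LP built from them may be averaged over that group.
-/

set_option linter.dupNamespace false
set_option autoImplicit false

namespace Summit.HodgeConjecture.HodgeConjecture.Cruxes.BlochSeedDiscOne.SlabRotation

open Summit.HodgeConjecture.HodgeConjecture.Cruxes.BlochSeedDiscOne.DepthBoundA4
open Summit.HodgeConjecture.HodgeConjecture.Cruxes.BlochSeedDiscOne.BoxIdentity (spro slab psi wt)

/-- **the phase shift:** `s_t(i·ℓ) = s_{t−1}(ℓ)` for the four projections `s_t ∈ {x+y, y−x, −x−y, x−y}`. -/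
theorem spro_rotI (t : Fin 4) (ℓ : Letter) : spro t ℓ.rotI = spro (t - 1) ℓ := by
  fin_cases t
  · show spro 0 ℓ.rotI = spro (0 - 1) ℓ
    have h : ((0 : Fin 4) - 1) = 3 := rfl
    rw [h]; simp only [spro, Letter.rotI]; ring
  · show spro 1 ℓ.rotI = spro (1 - 1) ℓ
    have h : ((1 : Fin 4) - 1) = 0 := rfl
    rw [h]; simp only [spro, Letter.rotI]; ring
  · show spro 2 ℓ.rotI = spro (2 - 1) ℓ
    have h : ((2 : Fin 4) - 1) = 1 := rfl
    rw [h]; simp only [spro, Letter.rotI]; ring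
  · show spro 3 ℓ.rotI = spro (3 - 1) ℓ
    have h : ((3 : Fin 4) - 1) = 2 := rfl
    rw [h]; simp only [spro, Letter.rotI]; ring

/-- **SLAB COVARIANCE:** `slab_t(i·ℓ) = slab_{t−1}(ℓ)` at every height. -/
theorem slab_rotI (hgt : ℤ) (t : Fin 4) (ℓ : Letter) : slab hgt t ℓ.rotI = slab hgt (t - 1) ℓ := by
  simp only [slab, spro_rotI, rotI_a]

/-- `n` quarter turns shift the phase by `n` (written as `n • 1` in `Fin 4`). -/
theorem slab_rotPow (hgt : ℤ) (n : ℕ) : ∀ (t : Fin 4) (ℓ : Letter), slab hgt t (ℓ.rotPow n) = slab hgt (t - n • (1 : Fin 4)) ℓ := by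
  induction n with
  | zero => intro t ℓ; rw [rotPow_zero, zero_nsmul, sub_zero]
  | succ n ih => intro t ℓ; rw [rotPow_succ, ih, slab_rotI, succ_nsmul, sub_sub]

/-- `j.val • 1 = j` in `Fin 4` (cast-free). -/
theorem val_smul_one (j : Fin 4) : j.val • (1 : Fin 4) = j := by
  fin_cases j <;> rfl

/-- **BOX COVARIANCE:** `ψ_x(rotCell k c) = ψ_{x − k}(c)` — rotating the cell by `k` is shifting the box by `−k`. -/
theorem psi_rotCell (hgt : ℤ) (x k : Fin 4 → Fin 4) (c : Cell) : psi hgt x (rotCell k c) = psi hgt (x - k) c := by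
  unfold psi rotCell
  refine Finset.prod_congr rfl fun f _ => ?_
  rw [slab_rotPow, val_smul_one, Pi.sub_apply]

/-- the box class moves by `−wt k`: `wt (x − k) = wt x − wt k`. -/
theorem wt_sub (x k : Fin 4 → Fin 4) : wt (x - k) = wt x - wt k := by
  unfold wt
  simp only [Pi.sub_apply]
  abel

/-- an `S₀` rotation (`InS0 k`: `Σ_f k_f ≡ 0 mod 4`) has `wt k = 0`. -/
theorem wt_eq_zero_of_inS0 (k : Fin 4 → Fin 4) (hk : InS0 k) : wt k = 0 := by
  apply Fin.ext
  simp only [InS0, Fin.sum_univ_four] at hk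
  simp only [wt, Fin.val_add, Fin.val_zero]
  omega

/-- hence **`S₀` rotations preserve the box class** of every box: `wt (x − k) = wt x`. -/
theorem wt_sub_of_inS0 (x k : Fin 4 → Fin 4) (hk : InS0 k) : wt (x - k) = wt x := by
  rw [wt_sub, wt_eq_zero_of_inS0 k hk, sub_zero]

/-- and therefore `ψ_x(rotCell k c) = ψ_{x'}(c)` with `x' := x − k` in the SAME class as `x` whenever `k ∈ S₀`. -/
theorem psi_rotCell_sameClass (hgt : ℤ) (x k : Fin 4 → Fin 4) (hk : InS0 k) (c : Cell) :
    psi hgt x (rotCell k c) = psi hgt (x - k) c ∧ wt (x - k) = wt x :=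
  ⟨psi_rotCell hgt x k c, wt_sub_of_inS0 x k hk⟩

end Summit.HodgeConjecture.HodgeConjecture.Cruxes.BlochSeedDiscOne.SlabRotation
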